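import Literature.Algebra.Polynomial.TaylorShiftStableSubspace
import Literature.RepresentationTheory.FiniteGroups.GL2ModularPrincipalSeriesLengthTwo
import HarnessLib

/-!
# The two Jordan–Hölder factors of the mod-`p` principal series of `GL₂(𝔽_p)` are non-isomorphic
# (`Sym^n ⊗ χ₁∘det ≄ Sym^n ⊗ χ₂∘det` for `χ₁ ≠ χ₂`; `(Sym^n)^N = k·X₀^n`)

Topic `Literature/RepresentationTheory/FiniteGroups`, namespace `Literature.RepresentationTheory.FiniteGroups.GL2`.
THEOREMS ONLY (no definition, no named fact, no instance, no notation, no `sorry`); sequel of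
(Coefficient note: the defining file `GL2ModularPrincipalSeries` now allows any commutative coefficient ring — the integral structure `Fun_R(Ind(χ₁ ⊗ χ₂))` of `GL2ModularPrincipalSeriesBruhatBasis` / `…Reduction` —; this file keeps `k` a field.)
`GL2ModularPrincipalSeriesLengthTwo` (`𝓑(χ₁, χ₂) = Ind_B^{GL₂(𝔽_p)}(χ₁ ⊗ χ₁ε^r)`, `0 < r < p − 1`, is uniserial of length
two with socle `Sym^r ⊗ χ₁∘det` and cosocle `≅ Sym^{p−1−r} ⊗ χ₂∘det`).

Source: M. Emerton, T. Gee, D. Savitt, *Lattices in the cohomology of Shimura curves* [EmertonGeeSavitt2015] §3.2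
(held `paper:arxiv-1305.1594`, p0011–p0012): the Jordan–Hölder factors `σ̄(χ)_J := σ̄_{t,s} ⊗ η'∘det`, `J ∈ 𝒫_{σ(χ)}`,
of `σ̄(χ)` are pairwise distinct Serre weights («the `σ̄(χ)_J` are precisely the Jordan–Hölder factors of `σ̄(χ)`»;
multiplicity-freeness of `σ̄(τ)` is the standing input of their §4, Lemma 4.1.1 «irreducible … residually multiplicity
free», formalised in the tree as `Literature.RepresentationTheory.eq_of_le_of_not_le_smul_of_socle`).  For `f = 1`:
`σ̄(χ)_∅ = Sym^r ⊗ χ₁∘det ≄ σ̄(χ)_{{0}} = Sym^{p−1−r} ⊗ χ₂∘det` — by dimension if `2r ≠ p − 1`, and by the action of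
the torus on the line of `N`-invariants if `r = (p−1)/2`.  J. E. Humphreys [Humphreys2005] §2.8 / §19.2 for the
weights of `S_n` («all weight multiplicities are 1»; highest weight vector `X₀^n`); D. Bump [Bump1997] §4.1 (torus
separation «we can find `t ∈ T(F)` such that `χ(t) ≠ μ(t)`»).

## What is proved (`F : Type` a field, `k` a field, `f : F →+* k`; then `F = 𝔽_p`, `CharP k p`)

* `exists_eq_smul_X_pow_of_upper_fixed` — **`(Sym^n k²)^{(1 1; 0 1)} = k·X₀^n`** when `1, …, n` are nonzero in `k`
  (dehomogenised: `f(X + 1) = f` with `deg f ≤ n` forces `f` constant — `Literature.Algebra.Polynomial.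
  natDegree_taylor_one_sub`);
* `isEmpty_equiv_symPowTwist` — **`Sym^n ⊗ χ₁∘det ≄ Sym^n ⊗ χ₂∘det`** as `GL₂(F)`-representations for `χ₁ ≠ χ₂`
  (an isomorphism preserves the `N`-fixed line; `diag(a, 1)` acts on it by `χᵢ(a) f(a)ⁿ`);
* `nonempty_equiv_symPowTwist_symPowSubrep` — the socle `symPowSubrep` of `𝓑(χ₁, χ₂)` IS (equivariantly isomorphic
  to) `Sym^r ⊗ χ₁∘det`, via `Φ`;
* **`isEmpty_equiv_socle_cosocle`** — for `χ₁ ≠ χ₂ = χ₁ε^r`, `r + s = p − 1`: no equivariant isomorphism between the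
  socle `Sym^r ⊗ χ₁∘det` of `𝓑(χ₁, χ₂)` and the socle `Sym^s ⊗ χ₂∘det` of `𝓑(χ₂, χ₁)` (= the cosocle of `𝓑(χ₁, χ₂)`,
  `ker_and_range_intertwining`): the socle constituent occurs exactly once in `σ̄(χ)`.
-/

namespace Literature.RepresentationTheory.FiniteGroups

namespace GL2

open Matrix

section TwistNonIso

open MvPolynomial

variable {F : Type} [Field F] [DecidableEq F] {k : Type*} [Field k] (f : F →+* k) {n : ℕ}

omit [DecidableEq F] in
/-- `X₀^n` is a binary form of degree `n`. [cite: Humphreys2005, §19.2 p.198] -/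
theorem X_zero_pow_mem (n : ℕ) : (X 0 ^ n : MvPolynomial (Fin 2) k) ∈ homogeneousSubmodule (Fin 2) k n :=
  (mem_homogeneousSubmodule _ _).mpr (isHomogeneous_X_pow _ _)

omit [DecidableEq F] in
/-- The matrix of `u(1)` over `k` is `(1 1; 0 1)`. [cite: Bump1997, §4.1 Eq. (1.7)] -/
theorem map_upperUnip_one : ((upperUnip F 1 : GL (Fin 2) F) : Matrix (Fin 2) (Fin 2) F).map f = !![1, 1; 0, 1] := by
  ext i j; fin_cases i <;> fin_cases j <;> simp

omit [DecidableEq F] in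
/-- The substitution of a diagonal matrix scales `X₀^n` by `a^n`. [cite: Humphreys2005, §19.2 p.198] -/
theorem mvPolynomialSubst_map_diagElt_X_zero_pow (a b : Fˣ) (n : ℕ) :
    mvPolynomialSubst (((diagElt F a b : GL (Fin 2) F) : Matrix (Fin 2) (Fin 2) F).map f) (X 0 ^ n) =
      (f a ^ n) • (X 0 ^ n : MvPolynomial (Fin 2) k) := by
  rw [map_pow, mvPolynomialSubst_X, Fin.sum_univ_two]
  simp only [Matrix.map_apply, coe_diagElt, Matrix.of_apply, Matrix.cons_val', Matrix.cons_val_zero,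
    Matrix.cons_val_one, Matrix.cons_val_fin_one, Matrix.empty_val', map_zero, zero_mul, add_zero]
  rw [mul_pow, ← C_pow, smul_eq_C_mul]

omit [DecidableEq F] in
/-- The upper unipotent fixes `X₀^n`. [cite: Humphreys2005, §19.2 p.198] -/
theorem mvPolynomialSubst_upper_X_zero_pow (n : ℕ) :
    mvPolynomialSubst (!![1, 1; 0, 1] : Matrix (Fin 2) (Fin 2) k) (X 0 ^ n) = X 0 ^ n := by
  rw [map_pow, mvPolynomialSubst_X, Fin.sum_univ_two]
  simp

omit [DecidableEq F] in
/-- **`(Sym^n)^N = k·X₀^n`**: a binary form of degree `n` fixed by the upper unipotent `(1 1; 0 1)` is a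
multiple of `X₀^n`, provided `1, …, n` are nonzero in `k` (dehomogenise: `f(X+1) = f` forces `f` constant,
as the finite difference would otherwise have degree `deg f − 1`). [cite: Humphreys2005, §2.8 p.16] -/
theorem exists_eq_smul_X_pow_of_upper_fixed (hn : ∀ j : ℕ, 0 < j → j ≤ n → (j : k) ≠ 0)
    {P : MvPolynomial (Fin 2) k} (hP : P ∈ homogeneousSubmodule (Fin 2) k n)
    (h : mvPolynomialSubst (!![1, 1; 0, 1] : Matrix (Fin 2) (Fin 2) k) P = P) :
    ∃ c : k, P = c • X 0 ^ n := by
  have hq : Polynomial.taylor 1 (dehom₁ P) = dehom₁ P := by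
    rw [← dehom₁_mvPolynomialSubst_upper, h]
  -- `dehom₁ P` is constant
  have hdeg : (dehom₁ P).natDegree = 0 := by
    by_contra hne
    obtain ⟨m, hm⟩ : ∃ m, (dehom₁ P).natDegree = m + 1 := ⟨_, (Nat.succ_pred_eq_of_ne_zero hne).symm⟩
    have hm1 : ((m + 1 : ℕ) : k) ≠ 0 :=
      hn (m + 1) (Nat.succ_pos m) (hm ▸ natDegree_dehom₁_le hP)
    obtain ⟨hne0, -⟩ := Literature.Algebra.Polynomial.natDegree_taylor_one_sub (dehom₁ P) m hm hm1
    exact hne0 (by rw [hq, sub_self])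
  obtain ⟨c, hc⟩ := Polynomial.natDegree_eq_zero.mp hdeg
  refine ⟨c, ?_⟩
  have hdiff : dehom₁ (P - c • X 0 ^ n) = 0 := by
    rw [map_sub, map_smul, map_pow, dehom₁_X_zero, one_pow, ← hc, Algebra.smul_def, mul_one,
      Polynomial.algebraMap_eq, sub_self]
  have := eq_zero_of_dehom₁_eq_zero (sub_mem hP (Submodule.smul_mem _ c (X_zero_pow_mem n))) hdiff
  exact sub_eq_zero.mp this

omit [DecidableEq F] in
/-- **Twists of `Sym^n` by distinct characters are not isomorphic**: if `χ₁ ≠ χ₂ : Fˣ → kˣ` and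
`1, …, n` are nonzero in `k`, there is no `GL₂(F)`-equivariant isomorphism `Sym^n ⊗ χ₁∘det ≅ Sym^n ⊗ χ₂∘det`
(an isomorphism maps the `N`-fixed line `k X₀^n` to itself; compare the action of `diag(a, 1)`, which is
`χᵢ(a) aⁿ` on it). [cite: EmertonGeeSavitt2015, §3.2] -/
theorem isEmpty_equiv_symPowTwist (hn : ∀ j : ℕ, 0 < j → j ≤ n → (j : k) ≠ 0) {χ₁ χ₂ : Fˣ →* kˣ}
    (hχ : χ₁ ≠ χ₂) : IsEmpty ((symPowTwist f χ₁ n).Equiv (symPowTwist f χ₂ n)) := by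
  refine ⟨fun e => hχ ?_⟩
  set P₀ : homogeneousSubmodule (Fin 2) k n := ⟨X 0 ^ n, X_zero_pow_mem n⟩ with hP₀
  have hP₀ne : P₀ ≠ 0 := fun h0 =>
    pow_ne_zero n (X_ne_zero (0 : Fin 2)) (congrArg Subtype.val h0)
  -- `u(1)` fixes `P₀` in both twists, and `diag(a,1)` acts by `χᵢ(a) f(a)^n`
  have hdetu : Matrix.GeneralLinearGroup.det (upperUnip F 1) = 1 :=
    Units.ext (by simp [Matrix.GeneralLinearGroup.val_det_apply, Matrix.det_fin_two_of])
  have hdetd : ∀ a : Fˣ, Matrix.GeneralLinearGroup.det (diagElt F a 1) = a := fun a =>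
    Units.ext (by simp [Matrix.GeneralLinearGroup.val_det_apply, Matrix.det_fin_two_of])
  have hu : ∀ χ : Fˣ →* kˣ, symPowTwist f χ n (upperUnip F 1) P₀ = P₀ := by
    intro χ
    rw [symPowTwist_apply, hdetu, map_one, Units.val_one, one_smul]
    exact Subtype.ext (by rw [coe_symPowGL_apply, map_upperUnip_one, hP₀, mvPolynomialSubst_upper_X_zero_pow])
  have hd : ∀ (χ : Fˣ →* kˣ) (a : Fˣ), symPowTwist f χ n (diagElt F a 1) P₀ = ((χ a : k) * f a ^ n) • P₀ := by
    intro χ a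
    rw [symPowTwist_apply, hdetd]
    refine Subtype.ext ?_
    rw [Submodule.coe_smul, coe_symPowGL_apply, hP₀, mvPolynomialSubst_map_diagElt_X_zero_pow,
      Submodule.coe_smul, smul_smul]
  -- `e P₀` is `u(1)`-fixed, hence a multiple of `P₀`
  have hfix : symPowGL f n (upperUnip F 1) (e P₀) = e P₀ := by
    have := Representation.IntertwiningMap.isIntertwining _ _ e.toIntertwiningMap (upperUnip F 1) P₀
    rw [hu χ₁] at this
    rw [Representation.Equiv.coe_toIntertwiningMap] at this
    have h2 : symPowTwist f χ₂ n (upperUnip F 1) (e P₀) = symPowGL f n (upperUnip F 1) (e P₀) := by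
      rw [symPowTwist_apply, hdetu, map_one, Units.val_one, one_smul]
    rw [← h2]
    exact this.symm
  obtain ⟨c, hc⟩ := exists_eq_smul_X_pow_of_upper_fixed hn (e P₀).2
    (by rw [← map_upperUnip_one f, ← coe_symPowGL_apply, hfix])
  have heP : e P₀ = c • P₀ := Subtype.ext (by rw [hc, Submodule.coe_smul])
  have hc0 : c ≠ 0 := by
    intro h0
    rw [h0, zero_smul] at heP
    exact hP₀ne (e.toLinearEquiv.injective (by rw [Representation.Equiv.toLinearEquiv_apply,
      Representation.Equiv.coe_toIntertwiningMap, heP, map_zero]))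
  ext a
  have h1 := Representation.IntertwiningMap.isIntertwining _ _ e.toIntertwiningMap (diagElt F a 1) P₀
  rw [Representation.Equiv.coe_toIntertwiningMap, hd χ₁, map_smul, heP, map_smul, hd χ₂, smul_smul,
    smul_smul] at h1
  have h1' := congrArg Subtype.val h1
  simp only [Submodule.coe_smul, hP₀] at h1'
  have h2 : ((χ₁ a : k) * f a ^ n * c - c * ((χ₂ a : k) * f a ^ n)) • (X 0 ^ n : MvPolynomial (Fin 2) k) = 0 := by
    rw [sub_smul, h1', sub_self]
  rw [smul_eq_zero] at h2
  rcases h2 with h2 | h2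
  · have hfa : f a ^ n ≠ 0 := pow_ne_zero n ((map_ne_zero f).mpr a.ne_zero)
    have : ((χ₁ a : k) - (χ₂ a : k)) * (f a ^ n * c) = 0 := by rw [← h2]; ring
    rcases mul_eq_zero.mp this with h3 | h3
    · exact sub_eq_zero.mp h3
    · exact absurd h3 (mul_ne_zero hfa hc0)
  · exact absurd h2 (pow_ne_zero n (X_ne_zero (0 : Fin 2)))

end TwistNonIso

section JordanHolder

open MvPolynomial

variable (p : ℕ) [Fact p.Prime] {k : Type*} [Field k] [CharP k p] {χ₁ χ₂ : (ZMod p)ˣ →* kˣ} {r s : ℕ}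

/-- The socle `Sym^r ⊗ χ₁∘det ⊂ 𝓑(χ₁, χ₂)` is equivariantly isomorphic to the twist `symPowTwist` (via `Φ`).
[cite: EmertonGeeSavitt2015, §3.2] -/
theorem nonempty_equiv_symPowTwist_symPowSubrep
    (hχ : ∀ a : (ZMod p)ˣ, (χ₂ a : k) = (χ₁ a : k) * ZMod.castHom (dvd_refl p) k a ^ r) (hr : r < p) :
    Nonempty ((symPowTwist (ZMod.castHom (dvd_refl p) k) χ₁ r).Equiv
      (symPowSubrep (ZMod.castHom (dvd_refl p) k) χ₁ χ₂ r hχ).toRepresentation) := by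
  have hr' : r < Fintype.card (ZMod p) := by rwa [ZMod.card]
  let e : homogeneousSubmodule (Fin 2) k r ≃ₗ[k]
      (symPowSubrep (ZMod.castHom (dvd_refl p) k) χ₁ χ₂ r hχ).toSubmodule :=
    LinearEquiv.ofInjective _ (symPowToPrincipalSeries_injective hχ hr')
  refine ⟨Representation.Equiv.mk e fun h => LinearMap.ext fun φ => Subtype.ext ?_⟩
  change symPowToPrincipalSeries _ χ₁ χ₂ r hχ (symPowTwist _ χ₁ r h φ) =
    principalSeriesRep (ZMod p) χ₁ χ₂ h (symPowToPrincipalSeries _ χ₁ χ₂ r hχ φ)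
  rw [symPowTwist_apply, symPowToPrincipalSeries_symPowGL]

/-- **The two Jordan–Hölder factors of `Ind_B^{GL₂(𝔽_p)}(χ₁ ⊗ χ₁ε^r)` are non-isomorphic** (`χ₁ ≠ χ₂`,
`r + s = p − 1`): the socle `Sym^r ⊗ χ₁∘det` and the cosocle `≅ Sym^s ⊗ χ₂∘det` (the socle of `𝓑(χ₂, χ₁)`, image of
the intertwining operator) admit no equivariant isomorphism — by dimension if `r ≠ s`, by the central/torus
character if `r = s`.  Hence the socle constituent occurs exactly ONCE in `σ̄(χ)` (multiplicity freeness, the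
hypothesis of the EGS lattice lemma `Literature.RepresentationTheory.eq_of_le_of_not_le_smul_of_socle`).
[cite: EmertonGeeSavitt2015, §3.2] -/
theorem isEmpty_equiv_socle_cosocle (hχne : χ₁ ≠ χ₂)
    (hχ : ∀ a : (ZMod p)ˣ, (χ₂ a : k) = (χ₁ a : k) * ZMod.castHom (dvd_refl p) k a ^ r)
    (hrs : r + s = p - 1) :
    IsEmpty ((symPowSubrep (ZMod.castHom (dvd_refl p) k) χ₁ χ₂ r hχ).toRepresentation.Equiv
      (symPowSubrep (ZMod.castHom (dvd_refl p) k) χ₂ χ₁ s (rel_symm p hχ hrs)).toRepresentation) := by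
  have hp : 2 ≤ p := (Fact.out : p.Prime).two_le
  have hr : r < p := by omega
  have hs : s < p := by omega
  refine ⟨fun e => ?_⟩
  obtain ⟨_, d1, _, d2, _⟩ := finrank_eq_of_rel p hχne hχ hrs
  by_cases hrs' : r = s
  · subst hrs'
    obtain ⟨e₁⟩ := nonempty_equiv_symPowTwist_symPowSubrep p hχ hr
    obtain ⟨e₂⟩ := nonempty_equiv_symPowTwist_symPowSubrep p (rel_symm p hχ hrs) hr
    exact (isEmpty_equiv_symPowTwist (ZMod.castHom (dvd_refl p) k) (natCast_ne_zero_of_lt_charP p hr)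
      hχne).false ((e₁.trans e).trans e₂.symm)
  · have := e.toLinearEquiv.finrank_eq
    omega

end JordanHolder

end GL2

end Literature.RepresentationTheory.FiniteGroups
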